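import Summits.HubbardSuperconductivity.HubbardSuperconductivity.Theorems.AnisotropyChordTransferFibre3N1RowExprC

/-!
# Route `AnisotropyChord` / H0 rotor rung, LEVEL 2 row `N₁`: SOUNDNESS of the staged cell checker (interval layer)

`…N1RowExprC` defines the Boolean `n1CellCheck c a₁ a₂ M₂ cmin (prec, iters)`: a staged box (`extendBox` over `specs M₂`), an
object stage (`encloseObjs` over `objSpecs M₂`), and three `rexprLeOn` claims on the final ten-variable box.  THIS FILE proves the
generic, physics-free half of its soundness: for ANY real vector `X : ℕ → ℝ` whose first sixteen coordinates lie in the cell box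
`c.box a₁ a₂`, whose staged coordinates satisfy their specs (`lo.eval X ≤ X_(16+j) ≤ hi.eval X`, each spec mentioning only earlier
coordinates — the Boolean `specsVarsOk`), and for ANY five reals `v` (the objects) with `lo.eval X ≤ v_j ≤ hi.eval X`
(`objSpecs`), `n1CellCheck … = true` gives `1 ≤ v₁ (= P̂)`, `1 ≤ U′(y)` and `cmin·U′(y) ≤ N₁′(y)` at the final vector
`y = (X₀, X₁, X₂, X₃, X₁₆, v₀, …, v₄)`.  Tools: `varsBelow`/`eval_congr_below` (a term's value depends only on the variables it
mentions), prefix membership `PMem`, `extendBox_sound` (induction on the specs, each step = `RExpr.eval_mem_enclose` on the box so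
far), `encloseObjs_sound`, `finalBox_mem`, ★ `n1CellCheck_sound`.  The physics half (the true profile satisfies the specs and the
object brackets; `c₁″ ≥ cmin` for the GM₃ certificate) is `…N1RowExprSound`.
Prover seat `hubbard-h0-rotor-p2` g4; helper for piece A = stmt-HubbardSuperconductivity-23918 of rung 19089
(`--supports`, helper class).  Nothing here proves superconductivity in the Hubbard model; helper lemmas of ONE conditional
reduction (the GM₃ ∀L certificate, Level-2 row `N₁`); the rotor TARGET as originally worded stays FALSE (g15 verdict).
Mathlib + the tree only; no sorry.
-/

set_option linter.dupNamespace false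
set_option autoImplicit false

open Literature.Analysis.ValidatedNumerics

namespace Summit.HubbardSuperconductivity.HubbardSuperconductivity.Theorems.AnisotropyChord.Transfer.Fibre3.L2.N1

/-! ## A term's value depends only on the variables it mentions -/

/-- all variable indices of `e` are `< n`. -/
def varsBelow (n : ℕ) : RExpr → Bool
  | .const _ => true
  | .var i => decide (i < n)
  | .add e₁ e₂ => varsBelow n e₁ && varsBelow n e₂
  | .sub e₁ e₂ => varsBelow n e₁ && varsBelow n e₂
  | .mul e₁ e₂ => varsBelow n e₁ && varsBelow n e₂
  | .neg e => varsBelow n e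
  | .sq e => varsBelow n e
  | .inv e => varsBelow n e
  | .abs e => varsBelow n e
  | .sqrt e => varsBelow n e
  | .min e₁ e₂ => varsBelow n e₁ && varsBelow n e₂
  | .max e₁ e₂ => varsBelow n e₁ && varsBelow n e₂

/-- two vectors agreeing below `n` give the same value to a term with variables below `n`. [folklore] -/
theorem eval_congr_below {n : ℕ} {x y : ℕ → ℝ} (hxy : ∀ i, i < n → x i = y i) :
    ∀ e : RExpr, varsBelow n e = true → e.eval x = e.eval y
  | .const _, _ => rfl
  | .var i, h => by
      simp only [varsBelow, decide_eq_true_eq] at h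
      exact hxy i h
  | .add e₁ e₂, h => by
      simp only [varsBelow, Bool.and_eq_true] at h
      simp only [RExpr.eval, eval_congr_below hxy e₁ h.1, eval_congr_below hxy e₂ h.2]
  | .sub e₁ e₂, h => by
      simp only [varsBelow, Bool.and_eq_true] at h
      simp only [RExpr.eval, eval_congr_below hxy e₁ h.1, eval_congr_below hxy e₂ h.2]
  | .mul e₁ e₂, h => by
      simp only [varsBelow, Bool.and_eq_true] at h
      simp only [RExpr.eval, eval_congr_below hxy e₁ h.1, eval_congr_below hxy e₂ h.2]
  | .neg e, h => by simp only [RExpr.eval, eval_congr_below hxy e h]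
  | .sq e, h => by simp only [RExpr.eval, eval_congr_below hxy e h]
  | .inv e, h => by simp only [RExpr.eval, eval_congr_below hxy e h]
  | .abs e, h => by simp only [RExpr.eval, eval_congr_below hxy e h]
  | .sqrt e, h => by simp only [RExpr.eval, eval_congr_below hxy e h]
  | .min e₁ e₂, h => by
      simp only [varsBelow, Bool.and_eq_true] at h
      simp only [RExpr.eval, eval_congr_below hxy e₁ h.1, eval_congr_below hxy e₂ h.2]
  | .max e₁ e₂, h => by
      simp only [varsBelow, Bool.and_eq_true] at h
      simp only [RExpr.eval, eval_congr_below hxy e₁ h.1, eval_congr_below hxy e₂ h.2]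

/-! ## Prefix membership and truncation -/

/-- `X` lies in `B` on the first `B.length` coordinates (nothing is asked beyond). -/
def PMem (B : Box) (X : ℕ → ℝ) : Prop := ∀ i, i < B.length → ((B.ivl i).1 : ℝ) ≤ X i ∧ X i ≤ ((B.ivl i).2 : ℝ)

/-- truncation of a vector beyond `n`. -/
noncomputable def trunc (X : ℕ → ℝ) (n : ℕ) : ℕ → ℝ := fun i => if i < n then X i else 0

/-- the truncation at `B.length` of a prefix-member lies in `B`. [folklore] -/
theorem mem_trunc {B : Box} {X : ℕ → ℝ} (h : PMem B X) : B.mem (trunc X B.length) := by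
  intro i
  unfold trunc
  by_cases hi : i < B.length
  · rw [if_pos hi]; exact h i hi
  · rw [if_neg hi]
    unfold Box.ivl
    rw [List.getD_eq_getElem?_getD, List.getElem?_eq_none (by omega)]
    simp

/-- a term with variables below `B.length` has the same value at `X` and at its truncation. [folklore] -/
theorem eval_trunc {B : Box} {X : ℕ → ℝ} (e : RExpr) (he : varsBelow B.length e = true) :
    e.eval (trunc X B.length) = e.eval X :=
  eval_congr_below (fun i hi => by unfold trunc; rw [if_pos hi]) e he

/-- ★ the basic enclosure step on a prefix-member: `lo.eval X ≤ u ≤ hi.eval X` and enclosures `I, J` of `lo, hi` on `B` give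
`I.fst ≤ u ≤ J.snd`. [folklore] -/
theorem encl_step {B : Box} {X : ℕ → ℝ} (h : PMem B X) {lo hi : RExpr} (hlo : varsBelow B.length lo = true)
    (hhi : varsBelow B.length hi = true) {u : ℝ} (h1 : lo.eval X ≤ u) (h2 : u ≤ hi.eval X) {prec iters : ℕ}
    {I J : NonemptyInterval ℚ} (hI : lo.enclose prec iters B.toIvl = some I) (hJ : hi.enclose prec iters B.toIvl = some J) :
    ((I.fst : ℚ) : ℝ) ≤ u ∧ u ≤ ((J.snd : ℚ) : ℝ) := by
  have := L2.unknown_mem_of_encl (mem_trunc h) (u := u) (by rw [eval_trunc lo hlo]; exact h1)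
    (by rw [eval_trunc hi hhi]; exact h2) hI hJ
  exact this

/-- prefix membership of an appended box. [folklore] -/
theorem pmem_append {B : Box} {X : ℕ → ℝ} (h : PMem B X) {lo hi : ℚ}
    (hu : ((lo : ℚ) : ℝ) ≤ X B.length ∧ X B.length ≤ ((hi : ℚ) : ℝ)) : PMem (B ++ [(lo, hi)]) X := by
  intro i hi'
  simp only [List.length_append, List.length_singleton] at hi'
  unfold Box.ivl
  by_cases hi1 : i < B.length
  · rw [List.getD_eq_getElem?_getD, List.getElem?_append_left hi1, ← List.getD_eq_getElem?_getD]
    exact h i hi1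
  · have hi2 : i = B.length := by omega
    subst hi2
    rw [List.getD_eq_getElem?_getD, List.getElem?_append_right (le_refl _), Nat.sub_self]
    simpa using hu

/-! ## Soundness of the staged extension -/

/-- the spec conditions from position `k` on: spec `j` mentions only variables `< k + j` and brackets `X (k + j)`. -/
def SpecsHold (X : ℕ → ℝ) : ℕ → List (RExpr × RExpr) → Prop
  | _, [] => True
  | k, s :: rest => (varsBelow k s.1 = true ∧ varsBelow k s.2 = true ∧ s.1.eval X ≤ X k ∧ X k ≤ s.2.eval X) ∧
      SpecsHold X (k + 1) rest

/-- ★ `extendBox` is sound: a prefix-member of `B` satisfying the specs from position `B.length` is a prefix-member of the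
extended box, whose length is `B.length + specs.length`. [folklore] -/
theorem extendBox_sound (prec iters : ℕ) (X : ℕ → ℝ) :
    ∀ (specs : List (RExpr × RExpr)) (B B' : Box), extendBox prec iters B specs = some B' → PMem B X →
      SpecsHold X B.length specs → PMem B' X ∧ B'.length = B.length + specs.length
  | [], B, B', h, hB, _ => by
      simp only [extendBox, Option.some.injEq] at h
      subst h; exact ⟨hB, by simp⟩
  | s :: rest, B, B', h, hB, hs => by
      obtain ⟨⟨hv1, hv2, h1, h2⟩, hrest⟩ := hs
      simp only [extendBox] at h
      split at h
      · rename_i I J hI hJ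
        have hu := encl_step hB hv1 hv2 h1 h2 hI hJ
        have hB1 : PMem (B ++ [(I.fst, J.snd)]) X := pmem_append hB hu
        have hlen : (B ++ [(I.fst, J.snd)]).length = B.length + 1 := by simp
        obtain ⟨hP, hl⟩ := extendBox_sound prec iters X rest _ B' h hB1 (by rw [hlen]; exact hrest)
        exact ⟨hP, by rw [hl, hlen, List.length_cons]; omega⟩
      · exact absurd h (by simp)

/-! ## Soundness of the object stage -/

/-- the object conditions: object `j` is bracketed by its spec, which mentions only variables `< n`. -/
def ObjsHold (X : ℕ → ℝ) (n : ℕ) : List (RExpr × RExpr) → List ℝ → Prop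
  | [], [] => True
  | s :: rest, v :: vs => (varsBelow n s.1 = true ∧ varsBelow n s.2 = true ∧ s.1.eval X ≤ v ∧ v ≤ s.2.eval X) ∧
      ObjsHold X n rest vs
  | _, _ => False

/-- the outcome: the list of rational brackets contains the objects, entry by entry. -/
def Bracketed : List (ℚ × ℚ) → List ℝ → Prop
  | [], [] => True
  | b :: bs, v :: vs => (((b.1 : ℚ) : ℝ) ≤ v ∧ v ≤ ((b.2 : ℚ) : ℝ)) ∧ Bracketed bs vs
  | _, _ => False

/-- ★ `encloseObjs` is sound. [folklore] -/
theorem encloseObjs_sound (prec iters : ℕ) {B : Box} {X : ℕ → ℝ} (hB : PMem B X) :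
    ∀ (objs : List (RExpr × RExpr)) (vs : List ℝ) (l : List (ℚ × ℚ)), encloseObjs prec iters B objs = some l →
      ObjsHold X B.length objs vs → Bracketed l vs
  | [], [], l, h, _ => by
      simp only [encloseObjs, Option.some.injEq] at h
      subst h; trivial
  | [], _ :: _, _, _, hh => by simp [ObjsHold] at hh
  | _ :: _, [], _, _, hh => by simp [ObjsHold] at hh
  | s :: rest, v :: vs, l, h, hh => by
      obtain ⟨⟨hv1, hv2, h1, h2⟩, hrest⟩ := hh
      simp only [encloseObjs] at h
      split at h
      · rename_i I J l' hI hJ hl'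
        simp only [Option.some.injEq] at h
        subst h
        exact ⟨encl_step hB hv1 hv2 h1 h2 hI hJ, encloseObjs_sound prec iters hB rest vs l' hl' hrest⟩
      · exact absurd h (by simp)

/-! ## The final vector and its box -/

/-- the final ten-variable vector `(X₀, X₁, X₂, X₃, X₁₆, v₀, …, v₄, 0, …)`. -/
noncomputable def finalVec (X : ℕ → ℝ) (vs : List ℝ) : ℕ → ℝ := fun i =>
  if i = 0 then X 0 else if i = 1 then X 1 else if i = 2 then X 2 else if i = 3 then X 3 else if i = 4 then X 16
  else vs.getD (i - 5) 0

/-- membership of the final vector in the final box. [folklore] -/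
theorem finalBox_mem {B : Box} {X : ℕ → ℝ} (hB : PMem B X) (hlen : 17 ≤ B.length) {l : List (ℚ × ℚ)} {vs : List ℝ}
    (hl : Bracketed l vs) : (finalBox B l).mem (finalVec X vs) := by
  -- entrywise brackets from `Bracketed`
  have hbr : ∀ (l : List (ℚ × ℚ)) (vs : List ℝ), Bracketed l vs → ∀ j,
      (((l.getD j (0, 0)).1 : ℚ) : ℝ) ≤ vs.getD j 0 ∧ vs.getD j 0 ≤ (((l.getD j (0, 0)).2 : ℚ) : ℝ) := by
    intro l
    induction l with
    | nil =>
      intro vs h j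
      cases vs with
      | nil => simp
      | cons _ _ => exact absurd h (by simp [Bracketed])
    | cons b bs ih =>
      intro vs h j
      cases vs with
      | nil => exact absurd h (by simp [Bracketed])
      | cons v vs' =>
        obtain ⟨hbv, hrest⟩ := h
        cases j with
        | zero => simpa using hbv
        | succ j' => simpa using ih vs' hrest j'
  have hx : ∀ i, i < B.length → ((B.getD i (0, 0)).1 : ℝ) ≤ X i ∧ X i ≤ ((B.getD i (0, 0)).2 : ℝ) := fun i hi => hB i hi
  intro i
  unfold Box.ivl finalBox finalVec
  by_cases h0 : i = 0
  · subst h0; simpa using hx 0 (by omega)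
  by_cases h1 : i = 1
  · subst h1; simpa using hx 1 (by omega)
  by_cases h2 : i = 2
  · subst h2; simpa using hx 2 (by omega)
  by_cases h3 : i = 3
  · subst h3; simpa using hx 3 (by omega)
  by_cases h4 : i = 4
  · subst h4; simpa using hx 16 (by omega)
  have hi5 : 5 ≤ i := by omega
  rw [if_neg h0, if_neg h1, if_neg h2, if_neg h3, if_neg h4]
  rw [List.getD_eq_getElem?_getD, List.getElem?_append_right (by simp; omega)]
  have e5 : i - [B.getD 0 (0, 0), B.getD 1 (0, 0), B.getD 2 (0, 0), B.getD 3 (0, 0), B.getD 16 (0, 0)].length = i - 5 := by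
    simp
  rw [e5, ← List.getD_eq_getElem?_getD]
  exact hbr l vs hl (i - 5)

/-! ## ★ Soundness of the cell check (interval layer) -/

/-- all specs mention only earlier coordinates (checked once per `M₂` by `decide`). -/
def specsVarsOk (M2 : ℕ) : Bool :=
  (((specs M2).zipIdx 16).all fun p => varsBelow p.2 p.1.1 && varsBelow p.2 p.1.2) &&
  ((objSpecs M2).all fun p => varsBelow (16 + (specs M2).length) p.1 && varsBelow (16 + (specs M2).length) p.2)

/-- the bookkeeping holds for `M₂ = 2` (the production block size). -/
theorem specsVarsOk_two : specsVarsOk 2 = true := by decide +kernel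

/-- from the Boolean `all` over `zipIdx` to `SpecsHold`, given the real bracket conditions. -/
theorem specsHold_of (X : ℕ → ℝ) :
    ∀ (sp : List (RExpr × RExpr)) (k : ℕ), ((sp.zipIdx k).all fun p => varsBelow p.2 p.1.1 && varsBelow p.2 p.1.2) = true →
      (∀ j (hj : j < sp.length), (sp[j].1).eval X ≤ X (k + j) ∧ X (k + j) ≤ (sp[j].2).eval X) → SpecsHold X k sp
  | [], _, _, _ => trivial
  | s :: rest, k, hall, hbr => by
      simp only [List.zipIdx_cons, List.all_cons, Bool.and_eq_true] at hall
      obtain ⟨⟨hv1, hv2⟩, hall'⟩ := hall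
      have h0 := hbr 0 (by simp)
      simp only [List.getElem_cons_zero, Nat.add_zero] at h0
      refine ⟨⟨hv1, hv2, h0.1, h0.2⟩, specsHold_of X rest (k + 1) (by simpa using hall') ?_⟩
      intro j hj
      have := hbr (j + 1) (by simp; omega)
      simp only [List.getElem_cons_succ] at this
      rw [show k + 1 + j = k + (j + 1) by omega]
      exact this

/-- from the Boolean `all` to `ObjsHold`, given the real bracket conditions (lists of equal length). -/
theorem objsHold_of (X : ℕ → ℝ) (n : ℕ) :
    ∀ (ob : List (RExpr × RExpr)) (vs : List ℝ), vs.length = ob.length →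
      (ob.all fun p => varsBelow n p.1 && varsBelow n p.2) = true →
      (∀ j (hj : j < ob.length) (hj' : j < vs.length), (ob[j].1).eval X ≤ vs[j] ∧ vs[j] ≤ (ob[j].2).eval X) → ObjsHold X n ob vs
  | [], [], _, _, _ => trivial
  | [], _ :: _, hl, _, _ => by simp at hl
  | _ :: _, [], hl, _, _ => by simp at hl
  | s :: rest, v :: vs, hl, hall, hbr => by
      simp only [List.all_cons, Bool.and_eq_true] at hall
      obtain ⟨⟨hv1, hv2⟩, hall'⟩ := hall
      have h0 := hbr 0 (by simp) (by simp)
      simp only [List.getElem_cons_zero] at h0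
      refine ⟨⟨hv1, hv2, h0.1, h0.2⟩, objsHold_of X n rest vs (by simpa using hl) (by simpa using hall') ?_⟩
      intro j hj hj'
      have := hbr (j + 1) (by simp; omega) (by simp; omega)
      simp only [List.getElem_cons_succ] at this
      exact this

/-- ★★ **SOUNDNESS OF `n1CellCheck` (interval layer).**  If the cell check passes and the spec bookkeeping is fine, then for
every real vector `X` in the cell box on its first sixteen coordinates whose staged coordinates satisfy the specs, and every
list of five object values bracketed by the object specs at `X`, the final vector `y = finalVec X vs` satisfies
`1 ≤ y₆` (`P̂ ≥ 1`), `1 ≤ U′(y)` and `cmin·U′(y) ≤ N₁′(y)` — hence `N₁′(y)/U′(y) ≥ cmin`. -/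
theorem n1CellCheck_sound (c : L2.NamedCell) (a1 a2 : ℚ) (M2 : ℕ) (cmin : ℚ) (pi : ℕ × ℕ)
    (h : n1CellCheck c a1 a2 M2 cmin pi = true) (hv : specsVarsOk M2 = true) (X : ℕ → ℝ) (hX : PMem (c.box a1 a2) X)
    (hsp : ∀ j (hj : j < (specs M2).length), ((specs M2)[j].1).eval X ≤ X (16 + j) ∧ X (16 + j) ≤ ((specs M2)[j].2).eval X)
    (vs : List ℝ) (hvl : vs.length = 5)
    (hob : ∀ j (hj : j < (objSpecs M2).length) (hj' : j < vs.length),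
      ((objSpecs M2)[j].1).eval X ≤ vs[j] ∧ vs[j] ≤ ((objSpecs M2)[j].2).eval X) :
    1 ≤ finalVec X vs 6 ∧ 1 ≤ UpE.eval (finalVec X vs) ∧
      (cmin : ℝ) * UpE.eval (finalVec X vs) ≤ N1pE.eval (finalVec X vs) := by
  have hlen0 : (c.box a1 a2).length = 16 := by simp [L2.NamedCell.box]
  simp only [specsVarsOk, Bool.and_eq_true] at hv
  obtain ⟨hv1, hv2⟩ := hv
  -- stage 1
  have hS : SpecsHold X (c.box a1 a2).length (specs M2) := by
    rw [hlen0]; exact specsHold_of X (specs M2) 16 hv1 hsp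
  unfold n1CellCheck cellFinalBox cellBox at h
  split at h
  · exact absurd h (by simp)
  · rename_i F hF
    split at hF
    · exact absurd hF (by simp)
    · rename_i B hB
      split at hF
      · exact absurd hF (by simp)
      · rename_i objs hobjs
        simp only [Option.some.injEq] at hF
        subst hF
        obtain ⟨hPB, hlenB⟩ := extendBox_sound pi.1 pi.2 X (specs M2) _ B hB hX hS
        -- stage 2
        have hO : ObjsHold X B.length (objSpecs M2) vs := by
          rw [hlenB, hlen0]
          exact objsHold_of X _ (objSpecs M2) vs (by rw [hvl]; simp [objSpecs]) hv2 hob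
        have hbr := encloseObjs_sound pi.1 pi.2 hPB (objSpecs M2) vs objs hobjs hO
        have hmem := finalBox_mem hPB (by
          rw [hlenB, hlen0]
          simp only [specs, List.length_append, List.length_cons, List.length_nil, List.length_map]
          omega) hbr
        -- the three claims
        simp only [Bool.and_eq_true] at h
        obtain ⟨⟨hP, hU⟩, hM⟩ := h
        have eP := rexprLeOn_sound hP _ hmem
        have eU := rexprLeOn_sound hU _ hmem
        have eM := rexprLeOn_sound hM _ hmem
        simp only [RExpr.eval] at eP eU eM
        refine ⟨?_, ?_, ?_⟩
        · have : (((-1 : ℚ)) : ℝ) = -1 := by push_cast; ring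
          simp only [fP, RExpr.eval] at eP
          rw [this] at eP
          linarith
        · have : (((-1 : ℚ)) : ℝ) = -1 := by push_cast; ring
          rw [this] at eU
          linarith
        · simp only [marginE, RExpr.eval, cst] at eM
          have : (((0 : ℚ)) : ℝ) = 0 := by push_cast; ring
          rw [this] at eM
          linarith

end Summit.HubbardSuperconductivity.HubbardSuperconductivity.Theorems.AnisotropyChord.Transfer.Fibre3.L2.N1
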